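import Summits.NavierStokesRegularity.NavierStokesRegularity.Theorems.PerpetualPumpAveragedTypeIBlowupPulseTools
import Summits.NavierStokesRegularity.NavierStokesRegularity.Theorems.PerpetualPumpAveragedTypeIBlowupOneStepCoreTools

/-!
# Crux `PerpetualPump.AveragedTypeIBlowup` (stmt-NavierStokesRegularity-1835), line `Sketch`:
# stub `handoff` — numerics of the hand-off

First tools file of the proof of the registered stub `stub_handoff` (the hand-off certificate of the
window one-step theorem; Mathlib-only mathematics). Pure real-arithmetic consequences of the regime:

* `handoff_sigmaP_le` — the pulse horizon `σ_P = (5 log x + 20)/x ≤ 1/10` for `x ≥ 10⁴` (the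
  registered tools sub-goal `stub_handoffTools`);
* `handoff_regime` — `η(b_hi+4)² ≤ 10⁻⁹`, `ε̄(b_hi+4)² ≤ 10⁻⁹`, and the powers of `q = √(1+ε₀)`;
* `handoff_lad` — monotonicity of the ladder profile `lad`;
* `handoff_forcing` — the forcing of the front's Toda gate in slow time is `≤ 1/2000`;
* `handoff_growth` — the growth bounds of the new level `B' = q β(σ_e)`;
* `handoff_levelOne_numeric` — the output of `stub_levelOneBond` (i) is `≤ F ε̄ B'`;
* `handoff_rise_numeric` — the arithmetic of the rise window of the next carrier.

## References

T. Tao, *Finite time blowup for an averaged three-dimensional Navier–Stokes equation*, J. Amer.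
Math. Soc. 29 (2016), §5–6 (the cascade heuristics); the content here is folklore arithmetic.
-/

noncomputable section

-- the summit namespace `…NavierStokesRegularity.NavierStokesRegularity…` is the tree convention
set_option linter.dupNamespace false

open Set

namespace Summit.NavierStokesRegularity.NavierStokesRegularity.Theorems.PerpetualPumpAveragedTypeIBlowup

/-- **The pulse horizon is at most a tenth of a slow unit**: `(5 log x + 20)/x ≤ 1/10`, and
`0 < (5 log x + 20)/x ≤ 1`, `x · σ_P = 5 log x + 20`, for `x ≥ 10⁴`. [folklore] -/
theorem handoff_sigmaP_le {x : ℝ} (hx : 10 ^ 4 ≤ x) :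
    (5 * Real.log x + 20) / x ≤ 1 / 10 ∧ 0 < (5 * Real.log x + 20) / x ∧
      (5 * Real.log x + 20) / x ≤ 1 ∧ x * ((5 * Real.log x + 20) / x) = 5 * Real.log x + 20 ∧
      0 ≤ Real.log x ∧ Real.log x ≤ x / 10 ^ 4 + 33 / 4 := by
  have hx0 : 0 < x := lt_of_lt_of_le (by norm_num) hx
  have hlog := pulse_log_le hx
  have hlog0 : 0 ≤ Real.log x := Real.log_nonneg (le_trans (by norm_num) hx)
  obtain ⟨hpos, hle1⟩ := oneStepCore_sigmaP_bounds hx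
  refine ⟨?_, hpos, hle1, mul_div_cancel₀ _ hx0.ne', hlog0, hlog⟩
  rw [div_le_iff₀ hx0]
  nlinarith

/-- **Registered tools sub-goal `stub_handoffTools`** of the stub `handoff` (line `Sketch`, crux
stmt-NavierStokesRegularity-1835): the pulse horizon `(5 log x + 20)/x` is at most `1/10` for
`x ≥ 10⁴`. [folklore] -/
theorem stub_handoffTools : ∀ x : ℝ, 10 ^ 4 ≤ x → (5 * Real.log x + 20) / x ≤ 1 / 10 :=
  fun _ hx => (handoff_sigmaP_le hx).1

set_option maxHeartbeats 400000 in
/-- **Regime numerics for the hand-off**: `η(b_hi+4)² ≤ 10⁻⁹`, `ε̄(b_hi+4)² ≤ 10⁻⁹`, and the powers of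
`q = √(1+ε₀)`: `0 < q`, `q² = 1+ε₀`, `q⁴ = (1+ε₀)²`, `1 ≤ q⁴ ≤ 111/100`, `1 ≤ q³ ≤ 6/5`,
`q⁵ ≤ 32/25`, `1 ≤ q ≤ 21/20`; and `η(b_hi+4)³ ≤ 10⁻⁹`. [folklore] -/
theorem handoff_regime {ε₀ εb η F bhi q : ℝ} (hε₀ : 0 < ε₀) (hε₀' : ε₀ ≤ 1 / 20) (hη : 0 ≤ η)
    (hεb : 0 < εb) (hF : 10 ^ 9 * (bhi + 4) ^ 4 ≤ F) (hbhi : 1 ≤ bhi + 4)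
    (hηreg : η * (10 ^ 9 * (bhi + 4) ^ 4 * (F + 1)) ≤ 1)
    (hεbreg : εb * (10 ^ 9 * (F + 1) ^ 2 * (bhi + 4) ^ 3) ≤ 1) (hq : q = Real.sqrt (1 + ε₀)) :
    η * (bhi + 4) ^ 2 ≤ 1 / 10 ^ 9 ∧ εb * (bhi + 4) ^ 2 ≤ 1 / 10 ^ 9 ∧ η * (bhi + 4) ≤ 1 / 10 ^ 9 ∧
      0 < q ∧ q ^ 2 = 1 + ε₀ ∧ q ^ 4 = (1 + ε₀) ^ 2 ∧ 1 ≤ q ^ 4 ∧ q ^ 4 ≤ 111 / 100 ∧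
      1 ≤ q ^ 3 ∧ q ^ 3 ≤ 6 / 5 ∧ q ^ 5 ≤ 32 / 25 ∧ 1 ≤ q ∧ q ≤ 21 / 20 ∧
      η * (bhi + 4) ^ 3 ≤ 1 / 10 ^ 9 := by
  have hF0 : 0 ≤ F := le_trans (by positivity) hF
  have hP2 : (bhi + 4) ≤ (bhi + 4) ^ 2 := by nlinarith
  have hP4 : (bhi + 4) ^ 2 ≤ (bhi + 4) ^ 4 := by nlinarith
  have hP3 : (bhi + 4) ^ 2 ≤ (bhi + 4) ^ 3 := by nlinarith
  have h1 : η * (bhi + 4) ^ 2 ≤ 1 / 10 ^ 9 := by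
    have : η * (bhi + 4) ^ 2 * 10 ^ 9 ≤ η * (10 ^ 9 * (bhi + 4) ^ 4 * (F + 1)) := by
      have h' : (bhi + 4) ^ 2 * 10 ^ 9 ≤ 10 ^ 9 * (bhi + 4) ^ 4 * (F + 1) := by nlinarith
      nlinarith
    rw [le_div_iff₀ (by norm_num)]
    linarith
  have h2 : εb * (bhi + 4) ^ 2 ≤ 1 / 10 ^ 9 := by
    have : εb * (bhi + 4) ^ 2 * 10 ^ 9 ≤ εb * (10 ^ 9 * (F + 1) ^ 2 * (bhi + 4) ^ 3) := by
      have h' : (bhi + 4) ^ 2 * 10 ^ 9 ≤ 10 ^ 9 * (F + 1) ^ 2 * (bhi + 4) ^ 3 := by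
        have : (1:ℝ) ≤ (F + 1) ^ 2 := by nlinarith
        nlinarith
      nlinarith
    rw [le_div_iff₀ (by norm_num)]
    linarith
  have h3 : η * (bhi + 4) ≤ 1 / 10 ^ 9 := le_trans (mul_le_mul_of_nonneg_left hP2 hη) h1
  have ha : (0 : ℝ) < 1 + ε₀ := by linarith
  have hq0 : 0 < q := by rw [hq]; exact Real.sqrt_pos.2 ha
  have hq2 : q ^ 2 = 1 + ε₀ := by rw [hq, Real.sq_sqrt ha.le]
  have hq4 : q ^ 4 = (1 + ε₀) ^ 2 := by rw [show q ^ 4 = (q ^ 2) ^ 2 by ring, hq2]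
  have hq1 : 1 ≤ q := by rw [hq]; exact Real.one_le_sqrt.2 (by linarith)
  have hq21 : q ≤ 21 / 20 := by rw [hq, Real.sqrt_le_left (by norm_num)]; nlinarith
  have hq41 : 1 ≤ q ^ 4 := by rw [hq4]; nlinarith
  have hq42 : q ^ 4 ≤ 111 / 100 := by rw [hq4]; nlinarith
  have hq31 : 1 ≤ q ^ 3 := one_le_pow₀ hq1
  have hq32 : q ^ 3 ≤ 6 / 5 := by
    have := pow_le_pow_left₀ hq0.le hq21 3
    exact this.trans (by norm_num)
  have hq5 : q ^ 5 ≤ 32 / 25 := by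
    have := pow_le_pow_left₀ hq0.le hq21 5
    exact this.trans (by norm_num)
  have h4 : η * (bhi + 4) ^ 3 ≤ 1 / 10 ^ 9 := by
    have hP34 : (bhi + 4) ^ 3 ≤ (bhi + 4) ^ 4 := by nlinarith
    have : η * (bhi + 4) ^ 3 * 10 ^ 9 ≤ η * (10 ^ 9 * (bhi + 4) ^ 4 * (F + 1)) := by
      have h' : (bhi + 4) ^ 3 * 10 ^ 9 ≤ 10 ^ 9 * (bhi + 4) ^ 4 * (F + 1) := by nlinarith
      nlinarith
    rw [le_div_iff₀ (by norm_num)]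
    linarith
  exact ⟨h1, h2, h3, hq0, hq2, hq4, hq41, hq42, hq31, hq32, hq5, hq1, hq21, h4⟩

/-- **The ladder profile** `lad j = ε̄ (1+ε₀)^{-19(j-2)}` (natural-number subtraction): every rung is
in `[0, ε̄]`, `lad 2 = ε̄`, and the profile is non-increasing. [folklore] -/
theorem handoff_lad {ε₀ εb : ℝ} {lad : ℕ → ℝ} (hε₀ : 0 ≤ ε₀) (hεb : 0 ≤ εb)
    (hlad : ∀ j : ℕ, lad j = εb * ((1 + ε₀) ^ (19 * (j - 2)))⁻¹) :
    (∀ j : ℕ, 0 ≤ lad j ∧ lad j ≤ εb) ∧ lad 2 = εb ∧ ∀ j : ℕ, lad (j + 1) ≤ lad j := by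
  have ha : (1 : ℝ) ≤ 1 + ε₀ := by linarith
  have ha0 : (0 : ℝ) < 1 + ε₀ := by linarith
  refine ⟨fun j => ?_, by rw [hlad]; norm_num, fun j => ?_⟩
  · rw [hlad]
    have h1 : (1 : ℝ) ≤ (1 + ε₀) ^ (19 * (j - 2)) := one_le_pow₀ ha
    have h2 : ((1 + ε₀) ^ (19 * (j - 2)))⁻¹ ≤ 1 := inv_le_one_of_one_le₀ h1
    exact ⟨mul_nonneg hεb (inv_nonneg.2 (by positivity)), by nlinarith [mul_le_mul_of_nonneg_left h2 hεb]⟩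
  · rw [hlad, hlad]
    refine mul_le_mul_of_nonneg_left ?_ hεb
    refine (inv_le_inv₀ (by positivity) (by positivity)).2 ?_
    exact pow_le_pow_right₀ ha (by omega)

set_option maxHeartbeats 400000 in
/-- **The forcing of the front's Toda gate in slow time is `≤ 1/2000`.** The three forcings are the
residuals (`≤ η ·` majorant) plus, respectively, the inflow `w_{n-1}²/q³ − ε̄ b w` of the spent
previous bond, the seed `ε̄ b²`, and the drain `−q³(w_{n+1}² + ε̄ b_{n+1} w_{n+1})` into the tiny next
bond; all are small in the pulse box. [folklore] -/
theorem handoff_forcing {q εb η bhi wl b w x y f1 f2 f3 m0 m1 m2 : ℝ} (hq1 : 1 ≤ q) (hq2 : q ≤ 21 / 20)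
    (hεb : 0 < εb) (hη : 0 ≤ η) (hεbhi : εb * (bhi + 4) ^ 2 ≤ 1 / 10 ^ 9)
    (hηhi : η * (bhi + 4) ^ 2 ≤ 1 / 10 ^ 9) (hηhi' : η * (bhi + 4) ≤ 1 / 10 ^ 9) (hbhi : 1 ≤ bhi + 4)
    (hwl : |wl| ≤ 1 / 200) (hb : |b| ≤ bhi + 4) (hw : |w| ≤ bhi + 4) (hx : |x| ≤ 2 * (bhi + 4))
    (hy : |y| ≤ 1 / 10 ^ 3) (hm0 : m0 ≤ 3 * (bhi + 4) ^ 2) (hm1 : m1 ≤ 5 * (bhi + 4) ^ 2)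
    (hm2 : m2 ≤ 2 * (bhi + 4))
    (hf1 : |f1 - (wl ^ 2 / q ^ 3 - εb * b * w)| ≤ η * m0) (hf2 : |f2 - εb * b ^ 2| ≤ η * m1)
    (hf3 : |f3 + q ^ 3 * (y ^ 2 + εb * x * y)| ≤ η * q ^ 3 * m2) :
    |f1| ≤ 1 / 2000 ∧ |f2| ≤ 1 / 2000 ∧ |f3| ≤ 1 / 2000 := by
  have hq0 : 0 < q := by linarith
  have hq3 : 1 ≤ q ^ 3 := one_le_pow₀ hq1
  have hq3' : q ^ 3 ≤ 6 / 5 := (pow_le_pow_left₀ hq0.le hq2 3).trans (by norm_num)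
  -- the inflow
  have hwl2 : wl ^ 2 / q ^ 3 ≤ 1 / 40000 := by
    rw [div_le_iff₀ (by positivity)]
    have : wl ^ 2 ≤ (1 / 200) ^ 2 := by
      have := abs_le.1 hwl
      nlinarith [sq_abs wl, abs_nonneg wl]
    nlinarith
  have hwl2' : 0 ≤ wl ^ 2 / q ^ 3 := by positivity
  -- |ε̄ b w| ≤ ε̄ (bhi+4)²
  have hbw : |εb * b * w| ≤ 1 / 10 ^ 9 := by
    rw [abs_mul, abs_mul, abs_of_pos hεb]
    calc εb * |b| * |w| ≤ εb * (bhi + 4) * (bhi + 4) := by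
          apply mul_le_mul (mul_le_mul_of_nonneg_left hb hεb.le) hw (abs_nonneg _) (by positivity)
      _ = εb * (bhi + 4) ^ 2 := by ring
      _ ≤ 1 / 10 ^ 9 := hεbhi
  have hm0' : η * m0 ≤ 3 / 10 ^ 9 := by nlinarith
  have hm1' : η * m1 ≤ 5 / 10 ^ 9 := by nlinarith
  have hm2' : η * q ^ 3 * m2 ≤ 3 / 10 ^ 9 := by
    have : η * q ^ 3 * m2 ≤ η * q ^ 3 * (2 * (bhi + 4)) :=
      mul_le_mul_of_nonneg_left hm2 (by positivity)
    nlinarith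
  have hb2 : |εb * b ^ 2| ≤ 1 / 10 ^ 9 := by
    rw [abs_mul, abs_of_pos hεb, abs_pow, pow_two]
    calc εb * (|b| * |b|) ≤ εb * ((bhi + 4) * (bhi + 4)) := by
          apply mul_le_mul_of_nonneg_left _ hεb.le
          exact mul_le_mul hb hb (abs_nonneg _) (by positivity)
      _ = εb * (bhi + 4) ^ 2 := by ring
      _ ≤ 1 / 10 ^ 9 := hεbhi
  have hy2 : y ^ 2 ≤ 1 / 10 ^ 6 := by
    have := abs_le.1 hy
    nlinarith [sq_abs y]
  have hxy : |εb * x * y| ≤ 2 / 10 ^ 12 := by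
    rw [abs_mul, abs_mul, abs_of_pos hεb]
    have hεx : εb * |x| ≤ 2 / 10 ^ 9 := by
      have h1 : εb * |x| ≤ εb * (2 * (bhi + 4)) := mul_le_mul_of_nonneg_left hx hεb.le
      have h2 : εb * (bhi + 4) ≤ 1 / 10 ^ 9 :=
        le_trans (mul_le_mul_of_nonneg_left (by nlinarith) hεb.le) hεbhi
      linarith
    calc εb * |x| * |y| ≤ 2 / 10 ^ 9 * (1 / 10 ^ 3) :=
          mul_le_mul hεx hy (abs_nonneg _) (by positivity)
      _ = 2 / 10 ^ 12 := by norm_num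
  have hdrain : |q ^ 3 * (y ^ 2 + εb * x * y)| ≤ 2 / 10 ^ 6 := by
    rw [abs_mul, abs_of_pos (by positivity : (0:ℝ) < q ^ 3)]
    have : |y ^ 2 + εb * x * y| ≤ 1 / 10 ^ 6 + 2 / 10 ^ 12 := by
      refine (abs_add_le _ _).trans ?_
      rw [abs_of_nonneg (sq_nonneg y)]
      linarith
    calc q ^ 3 * |y ^ 2 + εb * x * y| ≤ 6 / 5 * (1 / 10 ^ 6 + 2 / 10 ^ 12) :=
          mul_le_mul hq3' this (abs_nonneg _) (by positivity)
      _ ≤ 2 / 10 ^ 6 := by norm_num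
  refine ⟨?_, ?_, ?_⟩
  · obtain ⟨h₁, h₂⟩ := abs_le.1 hf1
    obtain ⟨h₃, h₄⟩ := abs_le.1 hbw
    exact abs_le.2 ⟨by linarith only [h₁, h₃, h₄, hm0', hwl2, hwl2'],
      by linarith only [h₂, h₃, h₄, hm0', hwl2, hwl2']⟩
  · obtain ⟨h₁, h₂⟩ := abs_le.1 hf2
    obtain ⟨h₃, h₄⟩ := abs_le.1 hb2
    exact abs_le.2 ⟨by linarith only [h₁, h₃, h₄, hm1'], by linarith only [h₂, h₃, h₄, hm1']⟩
  · obtain ⟨h₁, h₂⟩ := abs_le.1 hf3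
    obtain ⟨h₃, h₄⟩ := abs_le.1 hdrain
    exact abs_le.2 ⟨by linarith only [h₁, h₃, h₄, hm2'], by linarith only [h₂, h₃, h₄, hm2']⟩

/-- **Growth bounds of the new level.** With `τ₀ = R_n(t_ι − t₀) ≤ 3`, the ignition budgets NEW-1/NEW-2,
the pre-ignition envelope `B e^{-τ₀} − 3/2 ≤ b_n(t_ι) ≤ B e^{-τ₀} + 5/2`, the regime
`B ≥ 10⁴ + 40 + 5 log(1/ε̄)` and the pulse output `b_n(t_ι) − 6 log b_n(t_ι) − 30 ≤ β_e ≤ b_n(t_ι) + 1`,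
the new level `B' = q β_e` satisfies `q(B + log ε̄ − 6 log(B+2) − 58) ≤ B' ≤ q(B + log(10(F+2)ε̄B) + 25)`,
`3B/2 ≤ 2B'`, `0.98 (b_n(t_ι)+1) ≤ B'`, `0.99 b_n(t_ι) ≤ β_e`. [folklore] -/
theorem handoff_growth {εb F B Bp βe B' q τ0 : ℝ} (hεb : 0 < εb) (hεb1 : εb ≤ 1)
    (hblo : 10 ^ 4 + 40 - 5 * Real.log εb ≤ B) (hτ0 : 0 ≤ τ0) (hτ3 : τ0 ≤ 3)
    (hnew1 : B * (1 - Real.exp (-τ0)) ≤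
      max 0 (Real.log (6 / 10 * Real.sqrt (B + 4) / (εb * B))) + 6 * (τ0 + 1) + 2)
    (hlo : B * Real.exp (-τ0) - 3 / 2 ≤ Bp) (hhi : Bp ≤ B * Real.exp (-τ0) + 5 / 2)
    (hnew2 : Bp ≤ B + Real.log (10 * (F + 2) * εb * B) + 6 * (τ0 + 1))
    (hBp : 10 ^ 4 ≤ Bp) (hβlo : Bp - 6 * Real.log Bp - 30 ≤ βe) (hβhi : βe ≤ Bp + 1)
    (hq1 : 1 ≤ q) (hB' : B' = q * βe) :
    q * (B + Real.log εb - 6 * Real.log (B + 2) - 58) ≤ B' ∧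
    B' ≤ q * (B + Real.log (10 * (F + 2) * εb * B) + 25) ∧
    3 / 2 * B ≤ 2 * B' ∧ 98 / 100 * (Bp + 1) ≤ B' ∧ 99 / 100 * Bp ≤ βe ∧ Bp ≤ B + 5 / 2 ∧
    1 < B' ∧ βe ≤ B' ∧ 4 / 5 * B + 1980 ≤ Bp := by
  have hlogε : Real.log εb ≤ 0 := Real.log_nonpos hεb.le hεb1
  have hB4 : (10:ℝ) ^ 4 ≤ B := by linarith
  have hB0 : 0 < B := by linarith
  have hmax := oneStepCore_max_log_le hεb hεb1 (by linarith : (2:ℝ) ≤ B)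
  have hexp1 : Real.exp (-τ0) ≤ 1 := Real.exp_le_one_iff.2 (by linarith)
  have hexp0 : 0 ≤ Real.exp (-τ0) := (Real.exp_pos _).le
  have hBe : B * Real.exp (-τ0) ≤ B := mul_le_of_le_one_right hB0.le hexp1
  have hexpand : B * (1 - Real.exp (-τ0)) = B - B * Real.exp (-τ0) := by ring
  have hBp1 : B + Real.log εb - 55 / 2 ≤ Bp := by linarith
  have hBp2 : 4 / 5 * B + 1980 ≤ Bp := by linarith
  have hL := pulse_log_le hBp
  have hβe99 : 99 / 100 * Bp ≤ βe := by linarith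
  have hβe0 : 0 ≤ βe := by linarith
  have hB'βe : βe ≤ B' := by rw [hB']; exact le_mul_of_one_le_left hβe0 hq1
  have hq0 : 0 ≤ q := by linarith
  have hBp0 : 0 < Bp := by linarith
  -- log b_n(t_ι) ≤ log (B + 2) + 1/12
  have hB2e : Bp ≤ (B + 2) * Real.exp (1 / 12) := by
    have h1 := Real.add_one_le_exp (1 / 12 : ℝ)
    nlinarith
  have hlogBp : Real.log Bp ≤ Real.log (B + 2) + 1 / 12 := by
    have h1 : Real.log Bp ≤ Real.log ((B + 2) * Real.exp (1 / 12)) := Real.log_le_log hBp0 hB2e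
    rwa [Real.log_mul (by linarith) (Real.exp_pos _).ne', Real.log_exp] at h1
  refine ⟨?_, ?_, by linarith, by linarith, hβe99, by linarith, by linarith, hB'βe, hBp2⟩
  · rw [hB']
    exact mul_le_mul_of_nonneg_left (by linarith) hq0
  · rw [hB']
    exact mul_le_mul_of_nonneg_left (by linarith) hq0

/-- `e⁹ ≤ 10⁴` and `e¹³ < 450000`. [folklore] -/
theorem handoff_exp_bounds : Real.exp 9 ≤ 10 ^ 4 ∧ Real.exp 13 < 450000 := by
  have h1 : Real.exp 1 < 2.7182818286 := Real.exp_one_lt_d9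
  have h0 : 0 < Real.exp 1 := Real.exp_pos 1
  have h9 : Real.exp 9 = Real.exp 1 ^ 9 := by rw [← Real.exp_nat_mul]; norm_num
  have h13 : Real.exp 13 = Real.exp 1 ^ 13 := by rw [← Real.exp_nat_mul]; norm_num
  constructor
  · rw [h9]
    have : Real.exp 1 ^ 9 < 2.7182818286 ^ 9 := by gcongr
    exact this.le.trans (by norm_num)
  · rw [h13]
    calc Real.exp 1 ^ 13 < 2.7182818286 ^ 13 := by gcongr
      _ < 450000 := by norm_num

/-- **The output of `stub_levelOneBond` (i) at the argmax time is `≤ F ε̄ B'`.** With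
`Λ = 2 log b + 10`, `E = e^{q⁵Λ} ≤ b² · e^{0.56 log b} · e^{13}`, `σ_e ≤ (5 log b + 20)/b` and
`e^{0.56 log b}(5 log b + 20) ≤ 17 b`, the bound `E(y₀ + 3ε̄q²(b+1)²σ_e)` is `≤ 2.6·10⁷ ε̄ (b+1)⁴`, far
below `F ε̄ B' ≥ 9.8·10⁸ ε̄ (b+1)⁵` (`F ≥ 10⁹(b_hi+4)⁴`); likewise for the majorant bound. [folklore] -/
theorem handoff_levelOne_numeric {εb F bhi Bp B' q σe E : ℝ} (hBp : 10 ^ 4 ≤ Bp) (hq1 : 1 ≤ q)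
    (hq2 : q ≤ 21 / 20) (hεb : 0 < εb) (hσe0 : 0 ≤ σe) (hσe : σe ≤ (5 * Real.log Bp + 20) / Bp)
    (hF : 10 ^ 9 * (bhi + 4) ^ 4 ≤ F) (hPhi : Bp + 1 ≤ bhi + 4) (hB' : 98 / 100 * (Bp + 1) ≤ B')
    (hE : E = Real.exp (q ^ 5 * (2 * Real.log Bp + 10))) :
    E * (11 / 10 * εb + 3 * εb * q ^ 2 * (Bp + 1) ^ 2 * σe) ≤ F * εb * B' ∧
    4 * εb + 2 * ((q * (Bp + 1) + 1) * E * (11 / 10 * εb + 3 * εb * q ^ 2 * (Bp + 1) ^ 2 * σe) +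
      εb * q ^ 2 * (Bp + 1) ^ 2) ≤ F * εb * B' := by
  obtain ⟨he9, he13⟩ := handoff_exp_bounds
  set L := Real.log Bp with hLdef
  set P := Bp + 1 with hPdef
  have hBp0 : 0 < Bp := by linarith
  have hP1 : 1 ≤ P := by linarith
  have hP0 : 0 < P := by linarith
  have hL9 : 9 ≤ L := (Real.le_log_iff_exp_le hBp0).2 (he9.trans hBp)
  have hL0 : 0 ≤ L := by linarith
  have hexpL : Real.exp L = Bp := Real.exp_log hBp0
  have hq0 : 0 < q := by linarith
  have hq5 : q ^ 5 ≤ 32 / 25 := (pow_le_pow_left₀ hq0.le hq2 5).trans (by norm_num)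
  have hq2' : q ^ 2 ≤ 441 / 400 := (pow_le_pow_left₀ hq0.le hq2 2).trans (by norm_num)
  -- E ≤ b² e^{0.56 L} e^{13}
  have hE1 : E ≤ Bp ^ 2 * Real.exp (14 / 25 * L) * Real.exp 13 := by
    have h1 : q ^ 5 * (2 * L + 10) ≤ 2 * L + 14 / 25 * L + 13 := by
      have := mul_le_mul_of_nonneg_right hq5 (by linarith : 0 ≤ 2 * L + 10)
      linarith
    have h2 : Real.exp (2 * L + 14 / 25 * L + 13) = Bp ^ 2 * Real.exp (14 / 25 * L) * Real.exp 13 := by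
      rw [Real.exp_add, Real.exp_add, show 2 * L = L + L by ring, Real.exp_add, hexpL]
      ring
    rw [hE, ← h2]
    exact Real.exp_le_exp.2 h1
  -- e^{0.56 L} (5L + 20) ≤ 17 b and e^{0.56 L} ≤ b
  have hkey : Real.exp (14 / 25 * L) * (5 * L + 20) ≤ 17 * Bp := by
    have h1 : 11 / 25 * L ≤ Real.exp (11 / 25 * L) := by
      have := Real.add_one_le_exp (11 / 25 * L); linarith
    have h2 : 5 * L + 20 ≤ 17 * Real.exp (11 / 25 * L) := by linarith
    have h3 : Real.exp (14 / 25 * L) * Real.exp (11 / 25 * L) = Bp := by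
      rw [← Real.exp_add, show 14 / 25 * L + 11 / 25 * L = L by ring, hexpL]
    calc Real.exp (14 / 25 * L) * (5 * L + 20) ≤ Real.exp (14 / 25 * L) * (17 * Real.exp (11 / 25 * L)) :=
          mul_le_mul_of_nonneg_left h2 (Real.exp_pos _).le
      _ = 17 * Bp := by rw [← h3]; ring
  have hexp14 : Real.exp (14 / 25 * L) ≤ Bp := by
    rw [← hexpL]; exact Real.exp_le_exp.2 (by linarith)
  have he14 : 0 < Real.exp (14 / 25 * L) := Real.exp_pos _
  -- the slow factor
  have hσ' : Real.exp (14 / 25 * L) * σe ≤ 17 := by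
    have h1 : Real.exp (14 / 25 * L) * σe ≤ Real.exp (14 / 25 * L) * ((5 * L + 20) / Bp) :=
      mul_le_mul_of_nonneg_left hσe he14.le
    rw [mul_div_assoc', le_div_iff₀ hBp0] at h1
    exact le_of_mul_le_mul_right (h1.trans hkey) hBp0
  set S := 11 / 10 * εb + 3 * εb * q ^ 2 * (Bp + 1) ^ 2 * σe with hSdef
  have hS0 : 0 ≤ S := by positivity
  have hS1 : Real.exp (14 / 25 * L) * S ≤ εb * (11 / 10 * Bp + 57 * P ^ 2) := by
    have h1 : Real.exp (14 / 25 * L) * S =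
        11 / 10 * εb * Real.exp (14 / 25 * L) + 3 * εb * q ^ 2 * P ^ 2 * (Real.exp (14 / 25 * L) * σe) := by
      rw [hSdef]; ring
    rw [h1]
    have h2 : 3 * εb * q ^ 2 * P ^ 2 * (Real.exp (14 / 25 * L) * σe) ≤ 3 * εb * q ^ 2 * P ^ 2 * 17 :=
      mul_le_mul_of_nonneg_left hσ' (by positivity)
    have h3 : 51 * εb * P ^ 2 * q ^ 2 ≤ 51 * εb * P ^ 2 * (441 / 400) :=
      mul_le_mul_of_nonneg_left hq2' (by positivity)
    have h4 : 11 / 10 * εb * Real.exp (14 / 25 * L) ≤ 11 / 10 * εb * Bp :=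
      mul_le_mul_of_nonneg_left hexp14 (by positivity)
    have h5 : 0 ≤ εb * P ^ 2 := by positivity
    linarith
  have hY : E * S ≤ 26000000 * (εb * P ^ 4) := by
    have h4 : Bp ^ 2 ≤ P ^ 2 := by nlinarith
    have h5 : 11 / 10 * Bp + 57 * P ^ 2 ≤ 57774 / 1000 * P ^ 2 := by nlinarith
    have ha : Bp ^ 2 * Real.exp 13 ≤ P ^ 2 * 450000 :=
      mul_le_mul h4 he13.le (Real.exp_pos _).le (by positivity)
    calc E * S ≤ Bp ^ 2 * Real.exp (14 / 25 * L) * Real.exp 13 * S :=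
          mul_le_mul_of_nonneg_right hE1 hS0
      _ = Bp ^ 2 * Real.exp 13 * (Real.exp (14 / 25 * L) * S) := by ring
      _ ≤ Bp ^ 2 * Real.exp 13 * (εb * (11 / 10 * Bp + 57 * P ^ 2)) :=
          mul_le_mul_of_nonneg_left hS1 (by positivity)
      _ ≤ P ^ 2 * 450000 * (εb * (57774 / 1000 * P ^ 2)) :=
          mul_le_mul ha (mul_le_mul_of_nonneg_left h5 hεb.le) (by positivity) (by positivity)
      _ = 259983 * 100 * (εb * P ^ 4) := by ring
      _ ≤ 26000000 * (εb * P ^ 4) := by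
          have : 0 ≤ εb * P ^ 4 := by positivity
          linarith
  -- the target
  have hFB : 980000000 * (εb * P ^ 5) ≤ F * εb * B' := by
    have hP4 : P ^ 4 ≤ (bhi + 4) ^ 4 := pow_le_pow_left₀ hP0.le hPhi 4
    have hF' : 10 ^ 9 * P ^ 4 ≤ F := le_trans (by linarith) hF
    have h1 : 10 ^ 9 * P ^ 4 * εb ≤ F * εb := mul_le_mul_of_nonneg_right hF' hεb.le
    have h2 : 10 ^ 9 * P ^ 4 * εb * (98 / 100 * P) ≤ F * εb * B' :=
      mul_le_mul h1 hB' (by positivity) (mul_nonneg (le_trans (by positivity) hF) hεb.le)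
    have h3 : 10 ^ 9 * P ^ 4 * εb * (98 / 100 * P) = 980000000 * (εb * P ^ 5) := by ring
    linarith
  have hP5 : εb * P ^ 4 ≤ εb * P ^ 5 :=
    mul_le_mul_of_nonneg_left (pow_le_pow_right₀ hP1 (by norm_num)) hεb.le
  have hP25 : εb * P ^ 2 ≤ εb * P ^ 5 :=
    mul_le_mul_of_nonneg_left (pow_le_pow_right₀ hP1 (by norm_num)) hεb.le
  have hP05 : εb * 1 ≤ εb * P ^ 5 := mul_le_mul_of_nonneg_left (one_le_pow₀ hP1) hεb.le
  have hX0 : 0 ≤ εb * P ^ 4 := by positivity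
  refine ⟨by linarith, ?_⟩
  have h1 : (q * P + 1) * (E * S) ≤ (10501 / 10000 * P) * (26000000 * (εb * P ^ 4)) :=
    mul_le_mul (by nlinarith) hY (mul_nonneg (by rw [hE]; exact (Real.exp_pos _).le) hS0) (by positivity)
  have h1' : (10501 / 10000 * P) * (26000000 * (εb * P ^ 4)) = 27302600 * (εb * P ^ 5) := by ring
  have h2 : εb * q ^ 2 * P ^ 2 ≤ εb * (441 / 400) * P ^ 2 :=
    mul_le_mul_of_nonneg_right (mul_le_mul_of_nonneg_left hq2' hεb.le) (by positivity)
  linarith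

/-- **Arithmetic of the rise window of the next carrier** (`b ≥ 10⁴`): while the
carrier decreases at rate at most `q⁴ b/4 + 1/2000 + 1` (`q⁴ ≤ 1.11`) from the level `b/4`, it stays above
`(b+1)/5` for a time `1/(2(b+1))`; and it cannot climb from `b/4` to `0.99 b` in that time at rate
`≤ b² + q⁴/50 + 1/2000`. [folklore] -/
theorem handoff_rise_numeric {Bp q4 : ℝ} (hBp : 10 ^ 4 ≤ Bp) (hq42 : q4 ≤ 111 / 100) :
    (Bp + 1) / 5 ≤ Bp / 4 - (q4 * (Bp / 4) + 1 / 2000 + 1) * (1 / (2 * (Bp + 1))) ∧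
    (Bp ^ 2 + q4 / 50 + 1 / 2000) * (1 / (2 * (Bp + 1))) ≤ Bp / 2 ∧ 0 < 1 / (2 * (Bp + 1)) ∧
    1 / 50 ≤ Bp / 4 ∧ Bp / 4 + Bp / 2 < 99 / 100 * Bp := by
  have hP0 : 0 < 2 * (Bp + 1) := by linarith
  refine ⟨?_, ?_, by positivity, by linarith, by linarith⟩
  · have h1 : (q4 * (Bp / 4) + 1 / 2000 + 1) * (1 / (2 * (Bp + 1))) ≤ 7 / 50 := by
      rw [mul_one_div, div_le_iff₀ hP0]; nlinarith
    linarith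
  · rw [mul_one_div, div_le_iff₀ hP0]; nlinarith

end Summit.NavierStokesRegularity.NavierStokesRegularity.Theorems.PerpetualPumpAveragedTypeIBlowup

end
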